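import Literature.Probability.LatticeModels.IsingDecoration
import Literature.Probability.LatticeModels.GibbsSpecificationDLRProofs
import Literature.Probability.LatticeModels.GibbsSpecificationProofs
import Literature.Probability.LatticeModels.PlusMinusStateGibbs
import Literature.Probability.LatticeModels.IsingStateIdentification
import Literature.Probability.LatticeModels.FreeStateLimit
import HarnessLib

/-!
# The heat-bath (one-site DLR) identity in infinite volume; the plus state on local observables

For the nearest-neighbour Ising model at zero field the conditional law of one spin given all the
others is explicit: `σ_x` has conditional mean `tanh(β ∑_{y ∼ x} σ_y)`. In finite volume this is the
tree theorem `isingExpect_spinAt_mul_eq_tanh` (Friedli–Velenik 2017, Lemma 6.7 / Exercise 3.11). Here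
it is lifted to every infinite-volume DLR measure of the Ising specification (the DLR equation for the
one-site volume `{x}`, `IsGibbsMeasure.integral_integral_eq`), and in particular to the plus state
`plusExpect d β 0` on `ℤ^d` (through the plus Gibbs measure `exists_plusMeasure_holds` and
`integral_eq_plusExpect_of_forall_spinCorr`):

* `IsGibbsMeasure.integral_spinAt_mul_eq_integral_tanh_mul` — `∫ σ_x g dμ = ∫ tanh(β S_x) g dμ` for
  `μ ∈ 𝒢(β, 0)`, `g` bounded measurable not reading `σ_x` (Friedli–Velenik 2017, Lemma 6.7 with
  Def. 6.13; Georgii 2011, Rem. 1.24);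
* `exists_plusMeasure_integral_eq_plusExpect` — the plus state packaged: a translation-invariant
  DLR probability measure `μ⁺` with `⟨F⟩⁺_{β,h} = ∫ F dμ⁺` for every local `F`
  (Friedli–Velenik 2017, Thm. 3.17, Thm. 6.26);
* `plusExpect_spinAt_mul_eq_tanh` — the heat-bath identity in the plus state,
  `⟨σ_x g⟩⁺_{β,0} = ⟨tanh(β S_x) g⟩⁺_{β,0}` for local `g` not reading `σ_x`;
* `plusExpect_comp_add` — translation invariance of the plus state on local observables,
  `⟨F(σ(· + v))⟩⁺ = ⟨F⟩⁺` (Friedli–Velenik 2017, Thm. 3.17);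
* small tools: `integrable_of_dependsOn_finset`, `sum_neighborFinset_zdGraph_eq_sum_add`
  (`∑_{y ∼ x} f y = ∑_{y ∼ 0} f (y + x)`), `dependsOn_comp_add`.

These are the ingredients of Stein's method / the "DLR score" `σ_x − tanh(β S_x)` for the Ising
model (exactly mean zero against every local functional not reading `σ_x`).

References: S. Friedli, Y. Velenik, *Statistical Mechanics of Lattice Systems* (CUP 2017), Lemma 6.7,
eq. (6.5), Def. 6.13, Thm. 3.17, Thm. 6.26 [FriedliVelenik2017]; H.-O. Georgii, *Gibbs Measures and
Phase Transitions* (2011), Rem. 1.24 [Georgii2011].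
-/

noncomputable section

open MeasureTheory Filter Finset

namespace Literature.Probability.LatticeModels

/-! ### The one-site DLR identity for infinite-volume Gibbs measures -/

section General

variable {V : Type*} (G : SimpleGraph V) [DecidableEq V] [G.LocallyFinite] [Countable V]

/-- **Heat-bath (one-site DLR) identity for an infinite-volume Ising Gibbs measure at zero field.**
If `μ ∈ 𝒢(β, 0)` (DLR) and `g` is bounded, measurable and does not read the spin at `x`, then
`∫ σ_x g dμ = ∫ tanh(β ∑_{y∼x} σ_y) g dμ`: the DLR equation for the volume `{x}`
(`IsGibbsMeasure.integral_integral_eq`) reduces it to the finite-volume identity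
`isingExpect_spinAt_mul_eq_tanh` under every boundary condition (Friedli–Velenik 2017, Lemma 6.7,
eq. (6.5), with Def. 6.13; Georgii 2011, Rem. 1.24). [cite: FriedliVelenik2017, Lemma 6.7, eq. (6.5) and Def. 6.13] -/
theorem IsGibbsMeasure.integral_spinAt_mul_eq_integral_tanh_mul {β : ℝ}
    {μ : Measure (SpinConfig V)} (hμ : IsGibbsMeasure (isingSpecification G β 0) μ) (x : V)
    {g : SpinConfig V → ℝ} (hgm : Measurable g) (hgb : ∃ C, ∀ σ, |g σ| ≤ C)
    (hg : ∀ (σ : SpinConfig V) (u : ℤˣ), g (Function.update σ x u) = g σ) :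
    ∫ σ, spinAt x σ * g σ ∂μ =
      ∫ σ, Real.tanh (β * ∑ y ∈ G.neighborFinset x, spinAt y σ) * g σ ∂μ := by
  have hγ : IsSpecification (isingSpecification G β 0) :=
    isSpecification_isingSpecification_holds G β 0
  haveI := hμ.isProbabilityMeasure
  obtain ⟨C, hC⟩ := hgb
  have hm1 : Measurable fun σ : SpinConfig V => spinAt x σ * g σ := (measurable_spinAt x).mul hgm
  have hm2 : Measurable fun σ : SpinConfig V =>
      Real.tanh (β * ∑ y ∈ G.neighborFinset x, spinAt y σ) * g σ :=
    (measurable_tanh_comp ((Finset.measurable_sum _ fun y _ => measurable_spinAt y).const_mul β)).mul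
      hgm
  have hi1 : Integrable (fun σ : SpinConfig V => spinAt x σ * g σ) μ :=
    Integrable.of_bound hm1.aestronglyMeasurable C (Eventually.of_forall fun σ => by
      rw [Real.norm_eq_abs, abs_mul, abs_spinAt, one_mul]
      exact hC σ)
  have hi2 : Integrable (fun σ : SpinConfig V =>
      Real.tanh (β * ∑ y ∈ G.neighborFinset x, spinAt y σ) * g σ) μ :=
    Integrable.of_bound hm2.aestronglyMeasurable C (Eventually.of_forall fun σ => by
      rw [Real.norm_eq_abs, abs_mul]
      calc |Real.tanh (β * ∑ y ∈ G.neighborFinset x, spinAt y σ)| * |g σ| ≤ 1 * C :=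
            mul_le_mul (Real.abs_tanh_lt_one _).le (hC σ) (abs_nonneg _) zero_le_one
        _ = C := one_mul C)
  rw [← hμ.integral_integral_eq hγ {x} hi1, ← hμ.integral_integral_eq hγ {x} hi2]
  refine integral_congr_ae (Eventually.of_forall fun η => ?_)
  exact isingExpect_spinAt_mul_eq_tanh G (Finset.mem_singleton_self x) β η hgm hg

end General

/-! ### Local observables: small tools -/

section Local

variable {d : ℕ}

/-- A function of the spins in a finite set is integrable against any finite measure (it is bounded
and measurable, `DependsOn.exists_bound_of_finset`, `DependsOn.measurable_of_finset`). [folklore] -/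
theorem integrable_of_dependsOn_finset {V : Type*} [DecidableEq V] (μ : Measure (SpinConfig V))
    [IsFiniteMeasure μ] (D : Finset V) {F : SpinConfig V → ℝ} (hF : DependsOn F (↑D : Set V)) :
    Integrable F μ := by
  obtain ⟨C, hC⟩ := DependsOn.exists_bound_of_finset D hF
  exact Integrable.of_bound (DependsOn.measurable_of_finset D hF).aestronglyMeasurable C
    (Eventually.of_forall fun σ => by rw [Real.norm_eq_abs]; exact hC σ)

/-- A function of the spins in `D`, read after the translation `σ ↦ σ(· + v)`, is a function of the
spins in `D + v`. [folklore] -/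
theorem dependsOn_comp_add (D : Finset (Site d)) {F : SpinConfig (Site d) → ℝ}
    (hF : DependsOn F (↑D : Set (Site d))) (v : Site d) :
    DependsOn (fun σ : SpinConfig (Site d) => F (fun y => σ (y + v)))
      (↑(D.image (· + v)) : Set (Site d)) :=
  fun _ _ h => hF fun y hy => h (y + v) (by exact_mod_cast Finset.mem_image_of_mem (· + v) hy)

/-- A function of the spins in `D` does not read a spin outside `D`. [folklore] -/
theorem dependsOn_update_of_notMem {V : Type*} [DecidableEq V] (D : Finset V)
    {F : SpinConfig V → ℝ} (hF : DependsOn F (↑D : Set V)) {x : V} (hx : x ∉ D)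
    (σ : SpinConfig V) (u : ℤˣ) : F (Function.update σ x u) = F σ :=
  hF fun y hy => by
    have hyx : y ≠ x := fun h => hx (h ▸ Finset.mem_coe.1 hy)
    exact Function.update_of_ne hyx u σ

/-- The neighbours of `x` in `ℤ^d` are the translates by `x` of the neighbours of `0`:
`∑_{y ∼ x} f(y) = ∑_{y ∼ 0} f(y + x)`. [folklore] -/
theorem sum_neighborFinset_zdGraph_eq_sum_add {M : Type*} [AddCommMonoid M] (x : Site d)
    (f : Site d → M) :
    ∑ y ∈ (zdGraph d).neighborFinset x, f y = ∑ y ∈ (zdGraph d).neighborFinset 0, f (y + x) := by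
  refine Finset.sum_nbij' (fun y => y - x) (fun y => y + x) ?_ ?_ (fun y _ => sub_add_cancel y x)
    (fun y _ => add_sub_cancel_right y x) (fun y _ => by rw [sub_add_cancel])
  · intro y hy
    rw [SimpleGraph.mem_neighborFinset] at hy ⊢
    have h := (zdGraph_adj_shift_iff (-x) x y).2 hy
    rw [Site.shift_apply, Site.shift_apply, add_neg_cancel, ← sub_eq_add_neg] at h
    exact h
  · intro y hy
    rw [SimpleGraph.mem_neighborFinset] at hy ⊢
    have h := (zdGraph_adj_shift_iff x 0 y).2 hy
    rw [Site.shift_apply, Site.shift_apply, zero_add] at h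
    exact h

end Local

/-! ### The plus state on local observables -/

section Plus

variable {d : ℕ}

/-- **The plus state packaged as a measure.** For `β ≥ 0` and any `h` there is a probability measure
`μ⁺` on `{±1}^{ℤ^d}` which is a DLR (Gibbs) measure for the Ising specification, translation
invariant, has the plus correlations, and integrates EVERY local observable to its plus-state value:
`⟨F⟩⁺_{β,h} = ∫ F dμ⁺` whenever `F` depends on finitely many spins (Friedli–Velenik 2017, Thm. 3.17
and Thm. 6.26; tree: `exists_plusMeasure_holds`, `integral_eq_plusExpect_of_forall_spinCorr`). [cite: FriedliVelenik2017, Thm. 3.17 and Thm. 6.26] -/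
theorem exists_plusMeasure_integral_eq_plusExpect {β : ℝ} (hβ : 0 ≤ β) (h : ℝ) :
    ∃ μ : Measure (SpinConfig (Site d)), IsProbabilityMeasure μ ∧
      IsGibbsMeasure (isingSpecification (zdGraph d) β h) μ ∧ IsTranslationInvariantMeasure μ ∧
      (∀ A : Finset (Site d), spinCorr μ A = plusCorr d β h A) ∧
      ∀ (D : Finset (Site d)) (F : SpinConfig (Site d) → ℝ), DependsOn F (↑D : Set (Site d)) →
        plusExpect d β h F = ∫ σ, F σ ∂μ := by
  obtain ⟨μ, hμG, hμT, hμc⟩ := exists_plusMeasure_holds (d := d) (β := β) (h := h) hβ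
  have hG : IsGibbsMeasure (isingSpecification (zdGraph d) β h) μ := hμG
  haveI := hG.isProbabilityMeasure
  exact ⟨μ, inferInstance, hG, hμT, hμc, fun D F hF =>
    (integral_eq_plusExpect_of_forall_spinCorr hβ μ hμc hF).symm⟩

/-- **Translation invariance of the plus state on local observables**: for `β ≥ 0`, every `h`,
every local `F` and every `v ∈ ℤ^d`, `⟨F(σ(· + v))⟩⁺_{β,h} = ⟨F⟩⁺_{β,h}`
(Friedli–Velenik 2017, Thm. 3.17: `⟨·⟩⁺` is translation invariant). [cite: FriedliVelenik2017, Thm. 3.17] -/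
theorem plusExpect_comp_add {β : ℝ} (hβ : 0 ≤ β) (h : ℝ) {D : Finset (Site d)}
    {F : SpinConfig (Site d) → ℝ} (hF : DependsOn F (↑D : Set (Site d))) (v : Site d) :
    plusExpect d β h (fun σ => F (fun y => σ (y + v))) = plusExpect d β h F := by
  obtain ⟨μ, _, -, hμT, -, hμE⟩ := exists_plusMeasure_integral_eq_plusExpect (d := d) hβ h
  rw [hμE _ _ (dependsOn_comp_add D hF v), hμE D F hF]
  have e : (fun σ : SpinConfig (Site d) => F (fun y => σ (y + v))) =
      fun σ => F (configShift (-v) σ) := by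
    funext σ
    congr 1
    funext y
    rw [configShift_apply, sub_neg_eq_add]
  rw [e, ← integral_map_equiv (configShift (-v)) F, hμT (-v)]

/-- **Heat-bath (one-site DLR) identity in the plus state.** For `β ≥ 0`, a site `x ∈ ℤ^d` and a
local observable `g` not reading `σ_x` (`g` depends on the spins in a finite `D ∌ x`),
`⟨σ_x g⟩⁺_{β,0} = ⟨tanh(β ∑_{y∼x} σ_y) g⟩⁺_{β,0}`; equivalently the DLR score
`σ_x − tanh(β ∑_{y∼x} σ_y)` is orthogonal to every such `g` (Friedli–Velenik 2017, Lemma 6.7 with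
Thm. 6.26). [cite: FriedliVelenik2017, Lemma 6.7, eq. (6.5) and Thm. 6.26] -/
theorem plusExpect_spinAt_mul_eq_tanh {β : ℝ} (hβ : 0 ≤ β) (x : Site d) {D : Finset (Site d)}
    {g : SpinConfig (Site d) → ℝ} (hgD : DependsOn g (↑D : Set (Site d))) (hx : x ∉ D) :
    plusExpect d β 0 (fun σ => spinAt x σ * g σ) =
      plusExpect d β 0 (fun σ => Real.tanh (β * ∑ y ∈ (zdGraph d).neighborFinset x, spinAt y σ) * g σ) := by
  classical
  obtain ⟨μ, _, hμG, -, -, hμE⟩ := exists_plusMeasure_integral_eq_plusExpect (d := d) hβ 0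
  have h1 : DependsOn (fun σ : SpinConfig (Site d) => spinAt x σ * g σ)
      (↑(insert x D) : Set (Site d)) := fun σ τ hst => by
    dsimp only
    rw [hgD fun i hi => hst i (Finset.mem_coe.2 (Finset.mem_insert_of_mem (Finset.mem_coe.1 hi)))]
    simp only [spinAt, hst x (Finset.mem_coe.2 (Finset.mem_insert_self x D))]
  have h2 : DependsOn (fun σ : SpinConfig (Site d) =>
      Real.tanh (β * ∑ y ∈ (zdGraph d).neighborFinset x, spinAt y σ) * g σ)
      (↑((zdGraph d).neighborFinset x ∪ D) : Set (Site d)) := fun σ τ hst => by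
    dsimp only
    rw [hgD fun i hi => hst i (Finset.mem_coe.2 (Finset.mem_union_right _ (Finset.mem_coe.1 hi)))]
    congr 3
    exact Finset.sum_congr rfl fun y hy => by
      simp only [spinAt, hst y (Finset.mem_coe.2 (Finset.mem_union_left _ hy))]
  rw [hμE _ _ h1, hμE _ _ h2]
  exact hμG.integral_spinAt_mul_eq_integral_tanh_mul (zdGraph d) x
    (DependsOn.measurable_of_finset D hgD) (DependsOn.exists_bound_of_finset D hgD)
    (dependsOn_update_of_notMem D hgD hx)

/-- **The DLR score is centred against local functionals**: for `β ≥ 0`, `x ∈ ℤ^d` and local `g`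
not reading `σ_x`, `⟨(σ_x − tanh(β ∑_{y∼x} σ_y)) g⟩⁺_{β,0} = 0` (Friedli–Velenik 2017, Lemma 6.7
with Thm. 6.26). [cite: FriedliVelenik2017, Lemma 6.7, eq. (6.5) and Thm. 6.26] -/
theorem plusExpect_score_mul_eq_zero {β : ℝ} (hβ : 0 ≤ β) (x : Site d) {D : Finset (Site d)}
    {g : SpinConfig (Site d) → ℝ} (hgD : DependsOn g (↑D : Set (Site d))) (hx : x ∉ D) :
    plusExpect d β 0 (fun σ =>
      (spinAt x σ - Real.tanh (β * ∑ y ∈ (zdGraph d).neighborFinset x, spinAt y σ)) * g σ) = 0 := by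
  classical
  obtain ⟨μ, _, hμG, -, -, hμE⟩ := exists_plusMeasure_integral_eq_plusExpect (d := d) hβ 0
  have h1 : DependsOn (fun σ : SpinConfig (Site d) => spinAt x σ * g σ)
      (↑(insert x D) : Set (Site d)) := fun σ τ hst => by
    dsimp only
    rw [hgD fun i hi => hst i (Finset.mem_coe.2 (Finset.mem_insert_of_mem (Finset.mem_coe.1 hi)))]
    simp only [spinAt, hst x (Finset.mem_coe.2 (Finset.mem_insert_self x D))]
  have h2 : DependsOn (fun σ : SpinConfig (Site d) =>
      Real.tanh (β * ∑ y ∈ (zdGraph d).neighborFinset x, spinAt y σ) * g σ)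
      (↑((zdGraph d).neighborFinset x ∪ D) : Set (Site d)) := fun σ τ hst => by
    dsimp only
    rw [hgD fun i hi => hst i (Finset.mem_coe.2 (Finset.mem_union_right _ (Finset.mem_coe.1 hi)))]
    congr 3
    exact Finset.sum_congr rfl fun y hy => by
      simp only [spinAt, hst y (Finset.mem_coe.2 (Finset.mem_union_left _ hy))]
  have h3 : DependsOn (fun σ : SpinConfig (Site d) =>
      (spinAt x σ - Real.tanh (β * ∑ y ∈ (zdGraph d).neighborFinset x, spinAt y σ)) * g σ)
      (↑(insert x ((zdGraph d).neighborFinset x ∪ D)) : Set (Site d)) := fun σ τ hst => by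
    have e1 := h1 (fun i hi => hst i (by
      rcases Finset.mem_insert.1 (Finset.mem_coe.1 hi) with rfl | hi
      · exact Finset.mem_coe.2 (Finset.mem_insert_self _ _)
      · exact Finset.mem_coe.2 (Finset.mem_insert_of_mem (Finset.mem_union_right _ hi))))
    have e2 := h2 (fun i hi => hst i (Finset.mem_coe.2 (Finset.mem_insert_of_mem (Finset.mem_coe.1 hi))))
    simp only [sub_mul] at *
    rw [e1, e2]
  rw [hμE _ _ h3]
  simp_rw [sub_mul]
  rw [integral_sub (integrable_of_dependsOn_finset μ _ h1) (integrable_of_dependsOn_finset μ _ h2),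
    ← hμE _ _ h1, ← hμE _ _ h2, plusExpect_spinAt_mul_eq_tanh hβ x hgD hx, sub_self]

end Plus

end Literature.Probability.LatticeModels

end
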